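import Summits.QuantumAdvantage.AdviceFreeQNC0.EliminationLevelSets
import HarnessLib

/-!
# Cell qa-qnc0 (rung F-Q1, route RingFrame): the elimination FAIL PROFILE — `ElimFailProfile` (EFP) and `ElimFailLinear` (EFL)

Planner qa-qnc0-p1 gen 12, ROUND-11 §1 (the DENSITY axis), typed in `Sketch12.lean`, ask P16.  All
earlier rungs of the cell fix a CONSTANT loss and climb in degree (`elimHard`: degree `(log₂ n)^C`,
fail fraction `η₀`).  Here the degree `D` is arbitrary with `n ≥ λ₀·D` LINEAR, and the fail fraction is
exponentially small but explicit:

* **EFP** (`elimFailProfile : ElimFailProfile`, Sketch12 VERBATIM): there are `η₀, K > 0`, `λ₀, n₀` such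
  that for all `n ≥ n₀` and all `D` with `λ₀·D ≤ n`, every two-bit eliminator `(a, b, dec)` of degree
  `≤ D` on `n` bits names the TRUE residue `|u| mod 3` on at least `η₀·e^{−K·D²/n}·2ⁿ` inputs
  (`elimFailCount`, Sketch12 VERBATIM) — the Gaussian profile.
* **EFL** (`elimFailLinear : ElimFailLinear`, Sketch12 VERBATIM): with `c = 1/2` (`e^{1/2} < 2`): for
  `D ≥ D₀` and `n ≥ λ·D` the fail count is `≥ e^{−D/2}·2ⁿ > 2^{−D}·2ⁿ`.

Proof of EFP (ROUND-11 §1.4): the four level sets `{a = α, b = β}` (degree-`2D` indicators) partition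
the cube and the eliminator fails on `{a = α, b = β} ∩ {|u| ≡ dec(α,β)}`; at the scale `L = ⌊B√n⌋` or
`⌊A·n/(2D)⌋` (`exists_scale`: `2D ≤ A·n/L`, `n/L² ≤ 4/B² + 16D²/(A²n)`) SAL (`sparseAvoidLinear`) would
make every level set `2ⁿ/5`-small if the fail count were `≤ e^{−κn/L²}·2ⁿ` (`ElimProfile.lt_card_fail_of_avoid`, `EliminationLevelSets.lean`).
EFL: `K·D²/n ≤ D/4` for `n ≥ 4K·D` and `e^{−D/4} ≤ η₀` for `D ≥ 4/η₀`.  The cell's theorems (not in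
print).  WHAT THIS IS NOT: nothing on ring/walk strategies (`RingFailLinear` = T10, `RingFailProfile`
stay OPEN); no circuit payoff; crux α untouched; no separation.

## References

* S. Srinivasan, *A robust version of Hegedűs's lemma, with applications*, TheoretiCS 2 (2023),
  article 5, Lemma 3.1 [Srinivasan2023] (the engine, through `sparseAvoidLinear`).
-/

noncomputable section

namespace Summit.QuantumAdvantage.AdviceFreeQNC0

open Finset
open Literature.Computability.MetaComplexity Literature.Computability.MetaComplexity.Smolensky
open Literature.Computability.MetaComplexity.Hegedus

/-! ### The Sketch12 statements (verbatim) -/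

namespace ElimProfile

/-- The number of inputs `u ∈ {0,1}ⁿ` on which the eliminator `(a, b, dec)` names the TRUE residue
`|u| mod 3`, i.e. FAILS to eliminate (the quantity bounded below by `η₀·2ⁿ` in `elimHard`).
(Planner qa-qnc0-p1 Sketch12 `elimFailCount`, verbatim; declared as `ElimProfile.elimFailCount` because
the topic's `Elimination.lean` already owns `AdviceFreeQNC0.elimFailCount (c) (a b : _ → Bool)` — the
Boolean, fixed-target-class count of planner qa-qnc0-p2's ROUND-1; with `open ElimProfile` the Sketch12
statements below read token-verbatim.) -/
noncomputable def elimFailCount {n : ℕ} (a b : CubeFn (ZMod 2) n) (dec : ZMod 2 → ZMod 2 → ℕ) : ℕ :=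
  (univ.filter fun u : Fin n → Bool => dec (a u) (b u) % 3 = Hegedus.wt u % 3).card

end ElimProfile

open ElimProfile

/-- **EFP — elimination fail profile (Gaussian shape)** (planner qa-qnc0-p1 Sketch12, VERBATIM).  There
are `η₀, K > 0`, `λ₀, n₀` such that for all `n ≥ n₀` and all degrees `D` with `λ₀·D ≤ n`, every two-bit
eliminator of degree `≤ D` on `n` bits names the true residue on at least `η₀·e^{-K D²/n}·2ⁿ` inputs. -/
def ElimFailProfile : Prop :=
  ∃ η₀ : ℝ, 0 < η₀ ∧ ∃ K : ℝ, 0 < K ∧ ∃ lam n₀ : ℕ, ∀ n ≥ n₀, ∀ D : ℕ, lam * D ≤ n →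
    ∀ a b : CubeFn (ZMod 2) n, a ∈ lowDeg (ZMod 2) n D → b ∈ lowDeg (ZMod 2) n D →
      ∀ dec : ZMod 2 → ZMod 2 → ℕ,
        η₀ * Real.exp (-(K * (D : ℝ) ^ 2 / n)) * (2 : ℝ) ^ n ≤ (elimFailCount a b dec : ℝ)

/-- **EFL — elimination fail floor in the linear window, beating `2^{-D}`** (planner qa-qnc0-p1
Sketch12, VERBATIM).  There are `c > 0` with `e^{c} < 2`, and `λ, D₀`, such that for all `D ≥ D₀`
and all `n ≥ λ·D`, every degree-`≤ D` eliminator on `n` bits fails on at least `e^{-cD}·2ⁿ` inputs. -/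
def ElimFailLinear : Prop :=
  ∃ c : ℝ, 0 < c ∧ Real.exp c < 2 ∧ ∃ lam D₀ : ℕ, ∀ D ≥ D₀, ∀ n : ℕ, lam * D ≤ n →
    ∀ a b : CubeFn (ZMod 2) n, a ∈ lowDeg (ZMod 2) n D → b ∈ lowDeg (ZMod 2) n D →
      ∀ dec : ZMod 2 → ZMod 2 → ℕ,
        Real.exp (-(c * (D : ℝ))) * (2 : ℝ) ^ n ≤ (elimFailCount a b dec : ℝ)

/-! ### EFP and EFL -/

/-- **EFP — PROVED** (`η₀ = e^{−4κ/B²}`, `K = 16κ/A²`, `λ₀ = ⌈802/A⌉`, `n₀ = max(n₀^{SAL}, ⌈(401/B)²⌉)`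
from SAL's constants `A, B, κ`): the Sketch12 statement `ElimFailProfile`, verbatim.  The cell's
theorem (qa-qnc0-p1 ROUND-11 §1.4 / ask P16); engine [cite: Srinivasan2023, Lemma 3.1]. -/
theorem elimFailProfile : ElimFailProfile := by
  classical
  obtain ⟨A, hA, B, hB, κ, hκ, n₀, hS⟩ := sparseAvoidLinear
  refine ⟨Real.exp (-(4 * κ / B ^ 2)), Real.exp_pos _, 16 * κ / A ^ 2, by positivity,
    ⌈802 / A⌉₊, max n₀ ⌈(401 / B) ^ 2⌉₊, ?_⟩
  intro n hn D hD a b ha hb dec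
  have hn₀ : n₀ ≤ n := le_trans (le_max_left _ _) hn
  have hnR0 : (0 : ℝ) ≤ n := Nat.cast_nonneg _
  -- `401 ≤ B√n`
  have hnB : (401 : ℝ) ≤ B * Real.sqrt n := by
    have h1 : ((⌈(401 / B) ^ 2⌉₊ : ℕ) : ℝ) ≤ n := by
      exact_mod_cast le_trans (le_max_right _ _) hn
    have h2 : (401 / B) ^ 2 ≤ (n : ℝ) := (Nat.le_ceil _).trans h1
    have h3 : 401 / B ≤ Real.sqrt n := by
      rw [← Real.sqrt_sq (by positivity : (0 : ℝ) ≤ 401 / B)]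
      exact Real.sqrt_le_sqrt h2
    rw [div_le_iff₀ hB] at h3
    linarith
  -- `802·D ≤ A·n`
  have hnD : 802 * (D : ℝ) ≤ A * n := by
    have h1 : ((⌈802 / A⌉₊ * D : ℕ) : ℝ) ≤ n := by exact_mod_cast hD
    push_cast at h1
    have h2 : 802 / A * D ≤ (⌈802 / A⌉₊ : ℕ) * (D : ℝ) :=
      mul_le_mul_of_nonneg_right (Nat.le_ceil _) (Nat.cast_nonneg _)
    have h3 : 802 / A * D ≤ (n : ℝ) := h2.trans h1
    rw [div_mul_eq_mul_div, div_le_iff₀ hA] at h3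
    linarith
  obtain ⟨L, hL400, hLB, hDL, hnL⟩ := exists_scale hA hB hnB hnD
  have key := lt_card_fail_of_avoid (θ := Real.exp (-(κ * (n : ℝ) / (L : ℝ) ^ 2)) * (2 : ℝ) ^ n)
    (fun r g hg hS' => hS n hn₀ L hL400 hLB r (D + D) hDL g hg hS') a b ha hb dec
  -- `e^{−4κ/B²}·e^{−(16κ/A²)·D²/n} ≤ e^{−κn/L²}`
  have hexp : Real.exp (-(4 * κ / B ^ 2)) * Real.exp (-(16 * κ / A ^ 2 * (D : ℝ) ^ 2 / n)) ≤
      Real.exp (-(κ * (n : ℝ) / (L : ℝ) ^ 2)) := by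
    rw [← Real.exp_add]
    apply Real.exp_le_exp.2
    have h1 : κ * (n : ℝ) / (L : ℝ) ^ 2 ≤ κ * (4 / B ^ 2 + 16 * (D : ℝ) ^ 2 / (A ^ 2 * n)) := by
      rw [mul_div_assoc]
      exact mul_le_mul_of_nonneg_left hnL hκ.le
    have h2 : κ * (4 / B ^ 2 + 16 * (D : ℝ) ^ 2 / (A ^ 2 * n)) =
        4 * κ / B ^ 2 + 16 * κ / A ^ 2 * (D : ℝ) ^ 2 / n := by ring
    linarith
  have h2n : (0 : ℝ) ≤ (2 : ℝ) ^ n := by positivity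
  have := mul_le_mul_of_nonneg_right hexp h2n
  unfold elimFailCount
  linarith

/-- **EFL — PROVED** (`c = 1/2`, `λ = max(λ₀, 1, ⌈4K⌉)`, `D₀ = max(n₀, ⌈4/η₀⌉)` from EFP's constants):
the Sketch12 statement `ElimFailLinear`, verbatim — in the linear window `n ≥ λ·D` every degree-`≤ D`
eliminator fails on `≥ e^{−D/2}·2ⁿ > 2^{−D}·2ⁿ` inputs.  The cell's theorem (qa-qnc0-p1 ROUND-11 §1.4 /
ask P16); engine [cite: Srinivasan2023, Lemma 3.1]. -/
theorem elimFailLinear : ElimFailLinear := by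
  classical
  obtain ⟨η₀, hη₀, K, hK, lam, n₀, H⟩ := elimFailProfile
  refine ⟨1 / 2, by norm_num, ElimProfile.exp_half_lt_two, max (max lam 1) ⌈4 * K⌉₊,
    max n₀ ⌈4 / η₀⌉₊, ?_⟩
  intro D hD n hn a b ha hb dec
  have hlam : lam * D ≤ n :=
    le_trans (Nat.mul_le_mul_right _ ((le_max_left _ _).trans (le_max_left _ _))) hn
  have h1D : 1 * D ≤ n :=
    le_trans (Nat.mul_le_mul_right _ ((le_max_right _ _).trans (le_max_left _ _))) hn
  have hKD : ⌈4 * K⌉₊ * D ≤ n := le_trans (Nat.mul_le_mul_right _ (le_max_right _ _)) hn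
  have hn₀ : n₀ ≤ n := by
    have : n₀ ≤ D := le_trans (le_max_left _ _) hD
    omega
  have hDη : ⌈4 / η₀⌉₊ ≤ D := le_trans (le_max_right _ _) hD
  have hmain := H n hn₀ D hlam a b ha hb dec
  have hDR0 : (0 : ℝ) ≤ D := Nat.cast_nonneg _
  -- `K·D²/n ≤ D/4`
  have hKDn : K * (D : ℝ) ^ 2 / n ≤ (D : ℝ) / 4 := by
    rcases Nat.eq_zero_or_pos D with hD0 | hDpos
    · subst hD0; simp
    · have hnpos : 0 < n := by omega
      have hnR : (0 : ℝ) < n := by exact_mod_cast hnpos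
      have h1 : ((⌈4 * K⌉₊ * D : ℕ) : ℝ) ≤ n := by exact_mod_cast hKD
      push_cast at h1
      have h2 : 4 * K * (D : ℝ) ≤ (⌈4 * K⌉₊ : ℕ) * (D : ℝ) :=
        mul_le_mul_of_nonneg_right (Nat.le_ceil _) hDR0
      rw [div_le_iff₀ hnR]
      have h3 : 4 * K * (D : ℝ) ≤ n := h2.trans h1
      nlinarith only [h3, hDR0, hK]
  -- `e^{−D/4} ≤ η₀`
  have hDη' : Real.exp (-((D : ℝ) / 4)) ≤ η₀ := by
    have h1 : ((⌈4 / η₀⌉₊ : ℕ) : ℝ) ≤ D := by exact_mod_cast hDη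
    have h2 : 4 / η₀ ≤ (D : ℝ) := (Nat.le_ceil _).trans h1
    have hexp1 : Real.exp (-((D : ℝ) / 4)) ≤ 1 / (1 + (D : ℝ) / 4) := by
      rw [Real.exp_neg, ← one_div]
      exact one_div_le_one_div_of_le (by positivity)
        (by linarith [Real.add_one_le_exp ((D : ℝ) / 4)])
    refine hexp1.trans ?_
    rw [div_le_iff₀ (by positivity)]
    rw [div_le_iff₀ hη₀] at h2
    nlinarith only [h2, hη₀]
  -- assemble: `e^{−D/2} = e^{−D/4}·e^{−D/4} ≤ η₀·e^{−K D²/n}`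
  have hsplit : Real.exp (-(1 / 2 * (D : ℝ))) =
      Real.exp (-((D : ℝ) / 4)) * Real.exp (-((D : ℝ) / 4)) := by
    rw [← Real.exp_add]
    congr 1
    ring
  have hsecond : Real.exp (-((D : ℝ) / 4)) ≤ Real.exp (-(K * (D : ℝ) ^ 2 / n)) :=
    Real.exp_le_exp.2 (by linarith)
  have hprod : Real.exp (-(1 / 2 * (D : ℝ))) ≤ η₀ * Real.exp (-(K * (D : ℝ) ^ 2 / n)) := by
    rw [hsplit]
    exact mul_le_mul hDη' hsecond (Real.exp_nonneg _) hη₀.le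
  have h2n : (0 : ℝ) ≤ (2 : ℝ) ^ n := by positivity
  have := mul_le_mul_of_nonneg_right hprod h2n
  linarith

end Summit.QuantumAdvantage.AdviceFreeQNC0
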